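import Literature.NumberTheory.LFunctions.TuringMethodTrudgianNumericsCheck
import Literature.NumberTheory.LFunctions.LehmanCriticalLineBoundProofs
import Literature.NumberTheory.LFunctions.BookerLemmaProofs
import HarnessLib

/-!
# Trudgian's Theorem 2.2 (Turing's method): discharge of `abs_integral_zetaArgS_le_trudgian`

Topic `Literature/NumberTheory/LFunctions` (companion of `TuringMethod.lean`).  This file closes the
named fact `Literature.NumberTheory.LFunctions.abs_integral_zetaArgS_le_trudgian`
([Trudgian2011, Thm 2.2]: for `t₂ > t₁ > 168π`, `|∫_{t₁}^{t₂} S(t) dt| ≤ 2.067 + 0.059 log t₂`)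
with `theorem abs_integral_zetaArgS_le_trudgian_holds`, by assembling results proved elsewhere in
the tree along the lines of the printed proof [Trudgian2011, §2.2–§2.3]:

* Turing's lemma `π ∫_{t₁}^{t₂} S = U(t₂) − U(t₁)`, `U(t) = ∫_{1/2}^∞ log|ζ(σ+it)| dσ`
  [Trudgian2011, Lemma 2.4] (`Literature.NumberTheory.LFunctions.pi_mul_integral_zetaArgS_eq`,
  `ZetaArgVariation.lean`);
* the critical-line input `|ζ(½+it)| ≤ 2.53 t^{1/4}` for all `t > 1` [Trudgian2011, Lemma 2.5 and
  its footnote] — Lehman's Riemann–Siegel bound for `t ≥ 128π` and a kernel-checked certificate on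
  `1 ≤ t ≤ 404` (`Literature.NumberTheory.LFunctions.Trudgian2011_lemma_2_5_allT_holds`,
  `LehmanCriticalLineBoundProofs.lean`);
* Rademacher's Phragmén–Lindelöf theorem and the explicit convexity estimate, giving
  `U(t) ≤ a₁ + b₁ log t` [Trudgian2011, Lemmas 2.6–2.8] (`ZetaConvexityExplicit.lean`);
* Booker's lemma [Trudgian2011, Lemma 2.10]
  (`Literature.NumberTheory.LFunctions.Trudgian2011_lemma_2_10_holds`, `BookerLemmaProofs.lean`)
  and the Hadamard-product lower bound `−U(t) ≤ a₂ + b₂ log t` [Trudgian2011, Lemma 2.11]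
  (`Literature.NumberTheory.LFunctions.neg_setIntegral_Ioi_half_log_norm_riemannZeta_le'`,
  `TuringLowerBound.lean`), assembled as [Trudgian2011, Thm 2.12]
  (`Literature.NumberTheory.LFunctions.abs_integral_zetaArgS_le_trudgian_thm_2_12`);
* the numerical constants of [Trudgian2011, §2.3] (`c = 1.11`, `d = 3/4`: `b ≤ 0.0589`,
  `a + (b − 0.059) log(168π) ≤ 2.057`), certified by interval Euler–Maclaurin evaluations of
  `ζ(σ)`, `σ > 1` (`TuringMethodTrudgianNumerics.lean`) and evaluated once by `native_decide`
  (`Literature.NumberTheory.LFunctions.TrudgianNumerics.trudgianCheck_eq_true`,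
  `TuringMethodTrudgianNumericsCheck.lean`).

The only non-standard axiom in the closure of `abs_integral_zetaArgS_le_trudgian_holds` is the
`native_decide` auxiliary axiom of `TrudgianNumerics.trudgianCheck_eq_true` (trust in the Lean
compiler), declared to the gate as `computational`; there are no hypotheses and no named facts left.

## Main results (namespace `Literature.NumberTheory.LFunctions`)

* `abs_integral_zetaArgS_le_trudgian_holds` — **Trudgian 2011, Theorem 2.2**, unconditionally.
* `zetaZeroCount_le_of_turing_trudgian'`,
  `Literature.NumberTheory.DiophantineGeometry.RiemannHypothesisUpTo.of_turing_trudgian'` — the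
  two consumers of the fact in `TuringMethod.lean` (Turing's method with Trudgian's constants),
  with the hypothesis `(hTr : abs_integral_zetaArgS_le_trudgian)` discharged.

## References

* T. S. Trudgian, *Improvements to Turing's method*, Math. Comp. 80 (2011), 2259–2279, Thm 2.2,
  Lemmas 2.4–2.12, §2.3.  [Trudgian2011]
* A. R. Booker, *Artin's conjecture, Turing's method, and the Riemann hypothesis*, Experiment.
  Math. 15 (2006), 385–407, Lemma 4.4.  [Booker2006]
* R. S. Lehman, *On the distribution of zeros of the Riemann zeta-function*, Proc. LMS (3) 20
  (1970), 303–320, §3.  [Lehman1970]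
-/

noncomputable section

open Complex

namespace Literature.NumberTheory.LFunctions

/-- **Trudgian 2011, Theorem 2.2** (discharge of the named fact
`Literature.NumberTheory.LFunctions.abs_integral_zetaArgS_le_trudgian`): if `t₂ > t₁ > 168π` then
`|∫_{t₁}^{t₂} S(t) dt| ≤ 2.067 + 0.059 log t₂`.  Proof: Theorem 2.12 with `c = 1.11`, `d = 3/4`,
`t₀ = 168π` (`abs_integral_zetaArgS_le_trudgian_of_facts`, whose two remaining inputs — Lemma 2.5
on the whole line and Booker's Lemma 2.10 — are now theorems of the tree). [cite: Trudgian2011, Thm 2.2] -/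
theorem abs_integral_zetaArgS_le_trudgian_holds : abs_integral_zetaArgS_le_trudgian :=
  abs_integral_zetaArgS_le_trudgian_of_facts Trudgian2011_lemma_2_5_allT_holds
    Trudgian2011_lemma_2_10_holds

/-- Turing's method with Trudgian's 2011 bound, unconditionally (cf.
`zetaZeroCount_le_of_turing_trudgian`): for `168π < T`, `0 < h`, zeros `Z` of `ζ` on the critical
line with ordinates in `(T, T + h]` and
`2.067 + 0.059 log (T + h) + ∫_T^{T+h} (θ/π + 1) − Σ_{γ ∈ Z} (T + h − γ) < h (n + 1)`,
one has `N(T) ≤ n`. [cite: Trudgian2011, Thm 2.2] -/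
theorem zetaZeroCount_le_of_turing_trudgian' {T h : ℝ} {n : ℕ} (hT : 168 * Real.pi < T)
    (hh : 0 < h) (Z : Finset ℝ)
    (hZ : ∀ γ ∈ Z, riemannZeta (1 / 2 + γ * I) = 0 ∧ T < γ ∧ γ ≤ T + h)
    (hnum : 2.067 + 0.059 * Real.log (T + h)
        + (∫ t in T..T + h, (riemannSiegelTheta t / Real.pi + 1))
        - ∑ γ ∈ Z, (T + h - γ) < h * (n + 1)) :
    zetaZeroCount T ≤ n :=
  zetaZeroCount_le_of_turing_trudgian abs_integral_zetaArgS_le_trudgian_holds hT hh Z hZ hnum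

/-- Turing's method with Trudgian's 2011 bound, assembled and unconditional (cf.
`RiemannHypothesisUpTo.of_turing_trudgian`): for `168π < T`, `0 < h`, sign changes of Hardy's `Z`
at `0 ≤ t₀ < ⋯ < t_n ≤ T` and at `T ≤ s₀ < ⋯ < s_m ≤ T + h`, and the single inequality
`2.067 + 0.059 log (T + h) + ∫_T^{T+h} (θ/π + 1) − Σ_i (T + h − s_{i+1}) < h (n + 1)`, give
`RiemannHypothesisUpTo T ∧ N(T) = n ∧ N₀(T) = n`. [cite: Trudgian2011, Thm 2.2] -/
theorem _root_.Literature.NumberTheory.DiophantineGeometry.RiemannHypothesisUpTo.of_turing_trudgian'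
    {T h : ℝ} {n m : ℕ} (hT : 168 * Real.pi < T) (hh : 0 < h)
    (t : Fin (n + 1) → ℝ) (ht : StrictMono t) (ht0 : 0 ≤ t 0) (htn : t (Fin.last n) ≤ T)
    (htsign : ∀ i : Fin n, hardyZ (t i.castSucc) * hardyZ (t i.succ) < 0)
    (s : Fin (m + 1) → ℝ) (hs : StrictMono s) (hs0 : T ≤ s 0) (hsm : s (Fin.last m) ≤ T + h)
    (hssign : ∀ i : Fin m, hardyZ (s i.castSucc) * hardyZ (s i.succ) < 0)
    (hnum : 2.067 + 0.059 * Real.log (T + h)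
        + (∫ t in T..T + h, (riemannSiegelTheta t / Real.pi + 1))
        - ∑ i : Fin m, (T + h - s i.succ) < h * (n + 1)) :
    DiophantineGeometry.RiemannHypothesisUpTo T ∧ zetaZeroCount T = n ∧ criticalZeroCount T = n :=
  DiophantineGeometry.RiemannHypothesisUpTo.of_turing_trudgian abs_integral_zetaArgS_le_trudgian_holds
    hT hh t ht ht0 htn htsign s hs hs0 hsm hssign hnum

end Literature.NumberTheory.LFunctions

end
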